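import Summits.QuantumFields.YangMills.Theorems.F4SubCurvatureDoorLaplaceFourierRegistered
import Literature.Analysis.PDE.RellichSphericalMoments
import Literature.Analysis.Calculus.HarmonicPolynomialLaplacian
import Mathlib
import HarnessLib

/-!
# LINE g21-B «fibre dichotomy» (⟨stmt-QuantumFields-23125⟩) — B4 helper: the radial equation of the harmonic moments
# of a Helmholtz solution on `ℝ⁴` (weak and classical form, globally `C²` case)

Helper toward the registered stub B4 `stub_singleShellDichotomy` of `Cruxes/RationalToGeneral/Lines/fibre_dichotomy.lean`
(stub plan `Lines/fibre_dichotomy_stubplans.md`, step H3).  For `v ∈ C²(ℝ⁴)` with `Δ v = s v` on the set of points whose norm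
lies in an open `U ⊆ (0, ∞)`, and a HARMONIC homogeneous polynomial `Y` of degree `L` (Literature `MvPoly.toFun`, `MvPoly.lap`),
the harmonic moment `G(r) = ∫_{S³} Y(α) v(rα) dσ(α)` (`σ = volume.toSphere`) satisfies on `U` the radial equation

  `G'' + (3/r) G' − (L(L+2)/r² + s) G = 0`

— exactly the hypothesis shape of the landed rung R-B4a `RadialODEDichotomy`.  The computation is the template of
`Literature.Analysis.PDE.RellichSphericalMoments` / `RellichLemmaProofs.moment_ode` (Colton–Kress, Lemma 2.11) run in dimension `4`
with the harmonic weight `Y` instead of `⟪ξ,·⟫ⁿ` (so that NO coupling term appears): the Laplacian of the test function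
`θ(‖x‖) Y(x)` is `(θ'' + (3 + 2L) θ'/r) Y` (Leibniz rule, radial Laplacian, Euler's identity, `ΔY = 0`); Green's second identity
without boundary and polar coordinates give the weak equation; one integration by parts and du Bois-Reymond give the classical one.

Contents: `laplacian_toFun_eq`, `laplacian_radial_mul_harmonic`, `weak_radial_identity_harmonic`, `harmonicMoment_hasDerivAt`,
`harmonicMoment_ode`.  Mathlib + Literature only; no `sorry`; no new definitions.

HONEST LABEL: analysis helper for a registered stub of an OPEN line; B4, B5, S1, S2, ⟨23125⟩, ⟨23035⟩, R2d and the Yang–Mills mass gap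
remain OPEN; no summit is proved by a line.
-/

noncomputable section

open MeasureTheory MeasureTheory.Measure Set Function Filter Topology Metric Module InnerProductSpace
open scoped RealInnerProductSpace ContDiff Laplacian BigOperators

namespace Summit.QuantumFields.YangMills.Theorems.F4SubCurvatureDoorHarmonicMomentODE

open Literature.Analysis.Calculus.MvPoly (toFun lap toFun_smul_of_isHomogeneous contDiff_toFun fderiv_toFun_apply
  fderiv_toFun_single fderiv_toFun_self_of_isHomogeneous laplacian_toFun)
open Literature.Analysis.PDE.Rellich (hasDerivAt_moment hasDerivAt_moment_deriv continuous_moment_deriv₂ contDiff_comp_norm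
  hasCompactSupport_comp_norm laplacian_comp_norm integral_mul_laplacian_eq)

open Summit.QuantumFields.YangMills.Theorems.F4SubCurvatureDoorLaplaceFourierRegistered (E4)

/-! ## The Laplacian of a polynomial function and of the test function `θ(‖x‖) Y(x)` -/

/-- The analytic Laplacian of a polynomial function is the polynomial Laplacian: `Δ (toFun P) x = toFun (lap P) x`. -/
theorem laplacian_toFun_eq (P : MvPolynomial (Fin 4) ℝ) (x : E4) : (Δ (toFun P)) x = toFun (lap P) x := by
  rw [laplacian_eq_iteratedFDeriv_orthonormalBasis (toFun P) (EuclideanSpace.basisFun (Fin 4) ℝ)]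
  simp only [iteratedFDeriv_two_apply, Matrix.cons_val_zero, Matrix.cons_val_one, Matrix.cons_val_fin_one,
    EuclideanSpace.basisFun_apply]
  rw [laplacian_toFun]
  rfl

/-- **The Laplacian of the test function `θ(‖x‖) Y(x)`** at `x ≠ 0` for a harmonic homogeneous `Y` of degree `L` on `ℝ⁴`:
`Δ(θ(r) Y) = (θ''(r) + (3 + 2L) θ'(r)/r) · Y`, `r = ‖x‖` (Leibniz rule, radial Laplacian `θ'' + 3θ'/r`, Euler `x·∇Y = L Y`, `ΔY = 0`). -/
theorem laplacian_radial_mul_harmonic {θ : ℝ → ℝ} (hθ : ContDiff ℝ ∞ θ) (hθs : tsupport θ ⊆ Ioi 0)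
    {P : MvPolynomial (Fin 4) ℝ} {L : ℕ} (hP : P.IsHomogeneous L) (hharm : lap P = 0) {x : E4} (hx : x ≠ 0) :
    (Δ fun y : E4 => θ ‖y‖ * toFun P y) x =
      (deriv (deriv θ) ‖x‖ + (3 + 2 * L) * deriv θ ‖x‖ / ‖x‖) * toFun P x := by
  set b := EuclideanSpace.basisFun (Fin 4) ℝ
  have hΘ : ContDiff ℝ 2 (fun y : E4 => θ ‖y‖) := contDiff_infty.1 (contDiff_comp_norm hθ hθs) 2
  have hPc : ContDiff ℝ 2 (toFun P) := contDiff_toFun P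
  have hfd := (Literature.Analysis.FluidPDE.contDiff_comp_norm_of_tsupport_subset (E := E4) hθ hθs).2
  rw [Literature.Analysis.FluidPDE.laplacian_mul_eq b hΘ hPc x, laplacian_comp_norm hθ hθs hx, laplacian_toFun_eq, hharm,
    finrank_euclideanSpace_fin]
  -- the cross term `Σᵢ ∂ᵢΘ ∂ᵢY = (θ'/r) · (x·∇Y) = (θ'/r) L Y`
  have hcross : ∑ i, fderiv ℝ (fun y : E4 => θ ‖y‖) x (b i) * fderiv ℝ (toFun P) x (b i) =
      deriv θ ‖x‖ * ‖x‖⁻¹ * ((L : ℝ) * toFun P x) := by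
    have h4 : ∀ i, fderiv ℝ (fun y : E4 => θ ‖y‖) x (b i) * fderiv ℝ (toFun P) x (b i) =
        (deriv θ ‖x‖ * ‖x‖⁻¹) * (x i * toFun (MvPolynomial.pderiv i P) x) := fun i => by
      rw [hfd x]
      simp only [b, EuclideanSpace.basisFun_apply, _root_.FunLike.coe_smul, Pi.smul_apply, innerSL_apply_apply,
        smul_eq_mul, fderiv_toFun_single]
      rw [EuclideanSpace.inner_single_right]
      simp
      ring
    simp_rw [h4]
    rw [← Finset.mul_sum, ← fderiv_toFun_apply, fderiv_toFun_self_of_isHomogeneous hP]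
  rw [hcross]
  have hr : ‖x‖ ≠ 0 := norm_ne_zero_iff.2 hx
  simp only [Literature.Analysis.Calculus.MvPoly.toFun_zero]
  field_simp
  ring

/-- The test function `θ(‖x‖) Y(x)` is `C²` with compact support. -/
theorem contDiff_radial_mul_toFun {θ : ℝ → ℝ} (hθ : ContDiff ℝ ∞ θ) (hθs : tsupport θ ⊆ Ioi 0)
    (hθc : HasCompactSupport θ) (P : MvPolynomial (Fin 4) ℝ) :
    ContDiff ℝ 2 (fun y : E4 => θ ‖y‖ * toFun P y) ∧ HasCompactSupport (fun y : E4 => θ ‖y‖ * toFun P y) :=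
  ⟨contDiff_infty.1 ((contDiff_comp_norm hθ hθs).mul (contDiff_toFun P)) 2,
    (hasCompactSupport_comp_norm hθc).mul_right⟩

/-- The weight `α ↦ Y(α)` is continuous on the unit sphere. -/
theorem continuous_toFun_sphere (P : MvPolynomial (Fin 4) ℝ) :
    Continuous fun α : sphere (0 : E4) 1 => toFun P (α : E4) :=
  (contDiff_toFun (m := 0) P).continuous.comp continuous_subtype_val

/-! ## The weak radial equation -/

/-- **The weak radial equation of a harmonic moment.**  Let `v ∈ C²(ℝ⁴)` with `Δ v (x) = s · v x` whenever `‖x‖ ∈ U`,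
`U ⊆ (0, ∞)`; let `Y` be harmonic homogeneous of degree `L` and `G(r) = ∫ Y(α) v(rα) dσ` for `r > 0`.  Then for every smooth `θ`
compactly supported in `U`, `∫ (r^{L+3} θ'' + (2L+3) r^{L+2} θ' − s r^{L+3} θ) · G dr = 0`. -/
theorem weak_radial_identity_harmonic {v : E4 → ℝ} (hv : ContDiff ℝ 2 v) {s : ℝ} {U : Set ℝ} (hU : U ⊆ Ioi 0)
    (hpde : ∀ x : E4, ‖x‖ ∈ U → (Δ v) x = s * v x)
    {P : MvPolynomial (Fin 4) ℝ} {L : ℕ} (hP : P.IsHomogeneous L) (hharm : lap P = 0) {G : ℝ → ℝ}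
    (hG : ∀ r, 0 < r → G r = ∫ α, toFun P (α : E4) * v (r • (α : E4)) ∂(volume : Measure E4).toSphere)
    {θ : ℝ → ℝ} (hθ : ContDiff ℝ ∞ θ) (hθc : HasCompactSupport θ) (hθU : tsupport θ ⊆ U) :
    ∫ r, (r ^ (L + 3) * deriv (deriv θ) r + (2 * L + 3) * r ^ (L + 2) * deriv θ r - s * r ^ (L + 3) * θ r) * G r = 0 := by
  have hθs : tsupport θ ⊆ Ioi 0 := hθU.trans hU
  set σ := (volume : Measure E4).toSphere with hσ
  -- the test function and its Laplacian
  set φ : E4 → ℝ := fun y => θ ‖y‖ * toFun P y with hφ_def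
  obtain ⟨hφ, hφc⟩ := contDiff_radial_mul_toFun hθ hθs hθc P
  have hΔφc : Continuous (Δ φ) := Literature.Analysis.FluidPDE.continuous_laplacian hφ
  -- Green's second identity and the equation: `∫ v (Δφ − s φ) = 0`
  have green := integral_mul_laplacian_eq hv hφ hφc
  have hpde' : ∀ x, (Δ v) x * φ x = s * v x * φ x := fun x => by
    by_cases hx : ‖x‖ ∈ tsupport θ
    · rw [hpde x (hθU hx)]
    · have : φ x = 0 := by simp [hφ_def, image_eq_zero_of_notMem_tsupport hx]
      simp [this]
  have hΔφs : HasCompactSupport (Δ φ) :=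
    HasCompactSupport.intro hφc.isCompact fun x hx => Literature.Analysis.FluidPDE.laplacian_eq_zero_of_notMem_tsupport hx
  have hi1 : Integrable (fun x => v x * (Δ φ) x) (volume : Measure E4) :=
    (hv.continuous.mul hΔφc).integrable_of_hasCompactSupport hΔφs.mul_left
  have hi2 : Integrable (fun x => v x * φ x) (volume : Measure E4) :=
    (hv.continuous.mul hφ.continuous).integrable_of_hasCompactSupport hφc.mul_left
  have key : ∫ x, v x * ((Δ φ) x - s * φ x) = 0 := by
    have e1 : ∫ x, (Δ v) x * φ x = s * ∫ x, v x * φ x := by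
      rw [← integral_const_mul]
      exact integral_congr_ae (ae_of_all _ fun x => by simp only [hpde' x]; ring)
    have e2 : (fun x => v x * ((Δ φ) x - s * φ x)) = fun x => v x * (Δ φ) x - s * (v x * φ x) := funext fun x => by ring
    rw [e2, integral_sub hi1 (hi2.const_mul _), integral_const_mul, green, e1]
    ring
  -- polar coordinates
  set F : E4 → ℝ := fun x => v x * ((Δ φ) x - s * φ x) with hF
  have hFi : Integrable F (volume : Measure E4) := by
    have : F = fun x => v x * (Δ φ) x - s * (v x * φ x) := funext fun x => by simp only [hF]; ring
    rw [this]
    exact hi1.sub (hi2.const_mul _)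
  have polar := Literature.Analysis.FluidPDE.integral_eq_integral_Ioi_sphereIntegral (volume : Measure E4) hFi
  rw [key, finrank_euclideanSpace_fin] at polar
  -- the sphere integral of `F` at radius `r > 0`
  have hsph : ∀ r, 0 < r → Literature.Analysis.FluidPDE.sphereIntegral (volume : Measure E4) F r =
      ((deriv (deriv θ) r + (3 + 2 * L) * deriv θ r / r) * r ^ L - s * θ r * r ^ L) * G r := by
    intro r hr
    rw [Literature.Analysis.FluidPDE.sphereIntegral_def, hG r hr, ← integral_const_mul]
    refine integral_congr_ae (ae_of_all _ fun α => ?_)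
    have hx0 : r • (α : E4) ≠ 0 := by
      rw [Ne, smul_eq_zero, not_or]
      exact ⟨hr.ne', ne_zero_of_mem_unit_sphere α⟩
    have hnorm : ‖r • (α : E4)‖ = r := Literature.Analysis.FluidPDE.norm_smul_sphere hr.le α
    have hhom : toFun P (r • (α : E4)) = r ^ L * toFun P (α : E4) := toFun_smul_of_isHomogeneous hP r _
    simp only [hF, hφ_def]
    rw [laplacian_radial_mul_harmonic hθ hθs hP hharm hx0, hnorm, hhom]
    ring
  have polar' : ∫ r in Ioi (0 : ℝ), r ^ (4 - 1) • Literature.Analysis.FluidPDE.sphereIntegral (volume : Measure E4) F r =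
      ∫ r in Ioi (0 : ℝ), (r ^ (L + 3) * deriv (deriv θ) r + (2 * L + 3) * r ^ (L + 2) * deriv θ r
        - s * r ^ (L + 3) * θ r) * G r := by
    refine setIntegral_congr_fun measurableSet_Ioi fun r hr => ?_
    have hr0 : (r : ℝ) ≠ 0 := (mem_Ioi.1 hr).ne'
    rw [smul_eq_mul, hsph r hr]
    field_simp
    ring
  rw [polar'] at polar
  -- the integrand vanishes off `(0, ∞)`
  have hzero : ∀ r : ℝ, r ∉ Ioi 0 →
      (r ^ (L + 3) * deriv (deriv θ) r + (2 * L + 3) * r ^ (L + 2) * deriv θ r - s * r ^ (L + 3) * θ r) * G r = 0 := by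
    intro r hr
    have h0 : r ∉ tsupport θ := fun h => hr (hθs h)
    have h1 : r ∉ tsupport (deriv θ) := fun h => h0 (tsupport_deriv_subset h)
    have h2 : r ∉ tsupport (deriv (deriv θ)) := fun h => h1 (tsupport_deriv_subset h)
    rw [image_eq_zero_of_notMem_tsupport h0, image_eq_zero_of_notMem_tsupport h1, image_eq_zero_of_notMem_tsupport h2]
    ring
  rw [← setIntegral_eq_integral_of_forall_compl_eq_zero (s := Ioi (0 : ℝ)) fun r hr => hzero r hr]
  exact polar.symm

/-! ## The classical radial equation -/

/-- **Regularity of the harmonic moments**: for `v ∈ C²(ℝ⁴)`, `G(r) = ∫ Y v(r·)`, `G'(r) = ∫ Y Dv(rα)α`, `G''(r) = ∫ Y D²v(rα)(α,α)`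
satisfy `G' = dG/dr`, `G'' = dG'/dr` everywhere, and `G''` is continuous. -/
theorem harmonicMoment_hasDerivAt {v : E4 → ℝ} (hv : ContDiff ℝ 2 v) (P : MvPolynomial (Fin 4) ℝ) {G G' G'' : ℝ → ℝ}
    (hG : ∀ r, G r = ∫ α, toFun P (α : E4) * v (r • (α : E4)) ∂(volume : Measure E4).toSphere)
    (hG' : ∀ r, G' r = ∫ α, toFun P (α : E4) * fderiv ℝ v (r • (α : E4)) (α : E4) ∂(volume : Measure E4).toSphere)
    (hG'' : ∀ r, G'' r = ∫ α, toFun P (α : E4) * fderiv ℝ (fderiv ℝ v) (r • (α : E4)) (α : E4) (α : E4)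
      ∂(volume : Measure E4).toSphere) :
    (∀ r, HasDerivAt G (G' r) r) ∧ (∀ r, HasDerivAt G' (G'' r) r) ∧ Continuous G'' := by
  have hg := continuous_toFun_sphere P
  refine ⟨fun r => ?_, fun r => ?_, ?_⟩
  · have h := hasDerivAt_moment (hv.of_le one_le_two) hg r
    rw [← hG'] at h
    exact h.congr_of_eventuallyEq (Eventually.of_forall fun s => hG s)
  · have h := hasDerivAt_moment_deriv hv hg r
    rw [← hG''] at h
    exact h.congr_of_eventuallyEq (Eventually.of_forall fun s => hG' s)
  · exact (continuous_moment_deriv₂ hv hg).congr fun r => (hG'' r).symm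

/-- **The classical radial equation of a harmonic moment** (globally `C²` case).  Let `v ∈ C²(ℝ⁴)` with `Δ v = s v` at the points
whose norm lies in the open set `U ⊆ (0, ∞)`, `Y` harmonic homogeneous of degree `L`, and `G, G', G''` the three moments of
`harmonicMoment_hasDerivAt`.  Then `G'' + (3/r) G' − (L(L+2)/r² + s) G = 0` on `U`. -/
theorem harmonicMoment_ode {v : E4 → ℝ} (hv : ContDiff ℝ 2 v) {s : ℝ} {U : Set ℝ} (hUo : IsOpen U) (hU : U ⊆ Ioi 0)
    (hpde : ∀ x : E4, ‖x‖ ∈ U → (Δ v) x = s * v x)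
    {P : MvPolynomial (Fin 4) ℝ} {L : ℕ} (hP : P.IsHomogeneous L) (hharm : lap P = 0) {G G' G'' : ℝ → ℝ}
    (hG : ∀ r, G r = ∫ α, toFun P (α : E4) * v (r • (α : E4)) ∂(volume : Measure E4).toSphere)
    (hG' : ∀ r, G' r = ∫ α, toFun P (α : E4) * fderiv ℝ v (r • (α : E4)) (α : E4) ∂(volume : Measure E4).toSphere)
    (hG'' : ∀ r, G'' r = ∫ α, toFun P (α : E4) * fderiv ℝ (fderiv ℝ v) (r • (α : E4)) (α : E4) (α : E4)
      ∂(volume : Measure E4).toSphere) :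
    ∀ r ∈ U, G'' r + 3 / r * G' r - (((L : ℝ) * ((L : ℝ) + 2)) / r ^ 2 + s) * G r = 0 := by
  obtain ⟨hGd, hG'd, hG''c⟩ := harmonicMoment_hasDerivAt hv P hG hG' hG''
  have hGc : Continuous G := continuous_iff_continuousAt.2 fun r => (hGd r).continuousAt
  have hG'c : Continuous G' := continuous_iff_continuousAt.2 fun r => (hG'd r).continuousAt
  -- `A = L r^{L+2} G − r^{L+3} G'`, `B = −s r^{L+3} G`
  set A : ℝ → ℝ := fun r => L * r ^ (L + 2) * G r - r ^ (L + 3) * G' r with hA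
  set A' : ℝ → ℝ := fun r => L * (L + 2) * r ^ (L + 1) * G r + L * r ^ (L + 2) * G' r
    - ((L + 3) * r ^ (L + 2) * G' r + r ^ (L + 3) * G'' r) with hA'
  set B : ℝ → ℝ := fun r => -(s * r ^ (L + 3) * G r) with hB
  have hAd : ∀ r, HasDerivAt A (A' r) r := fun r => by
    have h1 := ((hasDerivAt_pow (L + 2) r).const_mul (L : ℝ)).mul (hGd r)
    have h2 := (hasDerivAt_pow (L + 3) r).mul (hG'd r)
    refine (h1.sub h2).congr_deriv ?_
    simp only [hA', show L + 2 - 1 = L + 1 from rfl, show L + 3 - 1 = L + 2 from rfl, Nat.cast_add, Nat.cast_ofNat]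
    ring
  have hA'c : Continuous A' := by
    simp only [hA']
    fun_prop
  have hBc : Continuous B := by
    simp only [hB]
    fun_prop
  -- the weak identity in the form `∫ θ B = -∫ θ' A`
  have hweak : ∀ θ : ℝ → ℝ, ContDiff ℝ ∞ θ → HasCompactSupport θ → tsupport θ ⊆ U →
      ∫ r, θ r * B r = -∫ r, deriv θ r * A r := by
    intro θ hθ hθc hθU
    have hW := weak_radial_identity_harmonic hv hU hpde hP hharm (G := G) (fun r _ => hG r) hθ hθc hθU
    -- one integration by parts: `∫ r^{L+3} θ'' G = -∫ θ' (r^{L+3} G)'`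
    have hdθ : ContDiff ℝ ∞ (deriv θ) := hθ.iterate_deriv 1
    have hdθd : Differentiable ℝ (deriv θ) := hdθ.differentiable (by simp)
    have hdθc : HasCompactSupport (deriv θ) := hθc.deriv
    have hddθc : HasCompactSupport (deriv (deriv θ)) := hdθc.deriv
    set Q : ℝ → ℝ := fun r => r ^ (L + 3) * G r with hQ
    set Q' : ℝ → ℝ := fun r => (L + 3) * r ^ (L + 2) * G r + r ^ (L + 3) * G' r with hQ'
    have hQd : ∀ r, HasDerivAt Q (Q' r) r := fun r => by
      refine ((hasDerivAt_pow (L + 3) r).mul (hGd r)).congr_deriv ?_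
      simp only [hQ', show L + 3 - 1 = L + 2 from rfl, Nat.cast_add, Nat.cast_ofNat]
    have hQc : Continuous Q := continuous_iff_continuousAt.2 fun r => (hQd r).continuousAt
    have hQ'c : Continuous Q' := by simp only [hQ']; fun_prop
    have hibp : ∫ r, Q r * deriv (deriv θ) r = -∫ r, Q' r * deriv θ r := by
      have e := integral_mul_fderiv_eq_neg_fderiv_mul_of_integrable (μ := (volume : Measure ℝ))
        (f := Q) (g := deriv θ) (v := 1) ?_ ?_ ?_ (fun r _ => (hQd r).differentiableAt) (fun r _ => hdθd r)
      · have e1 : (fun r => Q r * fderiv ℝ (deriv θ) r 1) = fun r => Q r * deriv (deriv θ) r :=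
          funext fun r => by rw [fderiv_apply_one_eq_deriv]
        have e2 : (fun r => fderiv ℝ Q r 1 * deriv θ r) = fun r => Q' r * deriv θ r :=
          funext fun r => by rw [fderiv_apply_one_eq_deriv, (hQd r).deriv]
        rw [e1, e2] at e
        exact e
      · have : (fun r => fderiv ℝ Q r 1 * deriv θ r) = fun r => Q' r * deriv θ r :=
          funext fun r => by rw [fderiv_apply_one_eq_deriv, (hQd r).deriv]
        rw [this]
        exact (hQ'c.mul hdθ.continuous).integrable_of_hasCompactSupport hdθc.mul_left
      · have : (fun r => Q r * fderiv ℝ (deriv θ) r 1) = fun r => Q r * deriv (deriv θ) r :=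
          funext fun r => by rw [fderiv_apply_one_eq_deriv]
        rw [this]
        exact (hQc.mul (hdθ.continuous_deriv (by simp))).integrable_of_hasCompactSupport hddθc.mul_left
      · exact (hQc.mul hdθ.continuous).integrable_of_hasCompactSupport hdθc.mul_left
    -- bookkeeping
    have hi1 : Integrable (fun r => Q r * deriv (deriv θ) r) (volume : Measure ℝ) :=
      (hQc.mul (hdθ.continuous_deriv (by simp))).integrable_of_hasCompactSupport hddθc.mul_left
    have hi2 : Integrable (fun r => ((2 * L + 3) * r ^ (L + 2) * G r) * deriv θ r) (volume : Measure ℝ) :=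
      ((by fun_prop : Continuous fun r : ℝ => (2 * L + 3) * r ^ (L + 2) * G r).mul
        hdθ.continuous).integrable_of_hasCompactSupport hdθc.mul_left
    have hi3 : Integrable (fun r => θ r * B r) (volume : Measure ℝ) :=
      (hθ.continuous.mul hBc).integrable_of_hasCompactSupport hθc.mul_right
    have hi4 : Integrable (fun r => Q' r * deriv θ r) (volume : Measure ℝ) :=
      (hQ'c.mul hdθ.continuous).integrable_of_hasCompactSupport hdθc.mul_left
    have hsplit : ∫ r, (r ^ (L + 3) * deriv (deriv θ) r + (2 * L + 3) * r ^ (L + 2) * deriv θ r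
        - s * r ^ (L + 3) * θ r) * G r =
        (∫ r, Q r * deriv (deriv θ) r) + (∫ r, ((2 * L + 3) * r ^ (L + 2) * G r) * deriv θ r) + ∫ r, θ r * B r := by
      have hi12 : Integrable (fun r => Q r * deriv (deriv θ) r + ((2 * L + 3) * r ^ (L + 2) * G r) * deriv θ r)
          (volume : Measure ℝ) := hi1.add hi2
      rw [← integral_add hi1 hi2, ← integral_add hi12 hi3]
      refine integral_congr_ae (ae_of_all _ fun r => ?_)
      simp only [hQ, hB]
      ring
    rw [hsplit, hibp] at hW
    have hcomb : -(∫ r, Q' r * deriv θ r) + (∫ r, ((2 * L + 3) * r ^ (L + 2) * G r) * deriv θ r) = ∫ r, deriv θ r * A r := by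
      have hi4n : Integrable (fun r => -(Q' r * deriv θ r)) (volume : Measure ℝ) := hi4.neg
      rw [← integral_neg, ← integral_add hi4n hi2]
      refine integral_congr_ae (ae_of_all _ fun r => ?_)
      simp only [hQ', hA]
      ring
    rw [hcomb] at hW
    linarith
  -- du Bois-Reymond: `A' = B` on `U` (the argument of `Literature.Analysis.PDE.RellichRadialODE.eqOn_of_integral_mul_eq`, inlined:
  -- integration by parts on the line and the fundamental lemma of the calculus of variations)
  have hAB : EqOn A' B U := by
    have hAc : Continuous A := continuous_iff_continuousAt.2 fun r => (hAd r).continuousAt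
    have hibp : ∀ φ : ℝ → ℝ, ContDiff ℝ ∞ φ → HasCompactSupport φ → ∫ r, deriv φ r * A r = -∫ r, φ r * A' r := by
      intro φ hφ hφc
      have hφd : Differentiable ℝ φ := hφ.differentiable (by simp)
      have hdφc : HasCompactSupport (deriv φ) := hφc.deriv
      have e := integral_mul_fderiv_eq_neg_fderiv_mul_of_integrable (μ := (volume : Measure ℝ))
        (f := A) (g := φ) (v := 1) ?_ ?_ ?_ (fun r _ => (hAd r).differentiableAt) (fun r _ => hφd r)
      · have e1 : ∫ r, A r * fderiv ℝ φ r 1 = ∫ r, deriv φ r * A r :=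
          integral_congr_ae (ae_of_all _ fun r => by
            dsimp only
            rw [fderiv_apply_one_eq_deriv, mul_comm])
        have e2 : ∫ r, fderiv ℝ A r 1 * φ r = ∫ r, φ r * A' r :=
          integral_congr_ae (ae_of_all _ fun r => by
            dsimp only
            rw [fderiv_apply_one_eq_deriv, (hAd r).deriv, mul_comm])
        rw [← e1, e, e2]
      · have : (fun x => fderiv ℝ A x 1 * φ x) = fun x => A' x * φ x := funext fun x => by
          rw [fderiv_apply_one_eq_deriv, (hAd x).deriv]
        rw [this]
        exact (hA'c.mul hφ.continuous).integrable_of_hasCompactSupport hφc.mul_left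
      · have : (fun r => A r * fderiv ℝ φ r 1) = fun r => A r * deriv φ r := funext fun r => by
          rw [fderiv_apply_one_eq_deriv]
        rw [this]
        exact (hAc.mul (hφ.continuous_deriv (by simp))).integrable_of_hasCompactSupport hdφc.mul_left
      · exact (hAc.mul hφ.continuous).integrable_of_hasCompactSupport hφc.mul_left
    have hloc : LocallyIntegrableOn (fun r => B r - A' r) U volume :=
      (hBc.sub hA'c).locallyIntegrable.locallyIntegrableOn U
    have hae := hUo.ae_eq_zero_of_integral_contDiff_smul_eq_zero hloc fun φ hφ hφc hφs => by
      have hi1 : Integrable (fun r => φ r * B r) (volume : Measure ℝ) :=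
        (hφ.continuous.mul hBc).integrable_of_hasCompactSupport hφc.mul_right
      have hi2 : Integrable (fun r => φ r * A' r) (volume : Measure ℝ) :=
        (hφ.continuous.mul hA'c).integrable_of_hasCompactSupport hφc.mul_right
      simp only [smul_eq_mul, mul_sub]
      rw [integral_sub hi1 hi2, hweak φ hφ hφc hφs, hibp φ hφ hφc]
      ring
    have hae' : (fun r => B r - A' r) =ᵐ[volume.restrict U] fun _ => (0 : ℝ) := (ae_restrict_iff' hUo.measurableSet).2 hae
    have heq := Measure.eqOn_open_of_ae_eq hae' hUo (hBc.sub hA'c).continuousOn continuousOn_const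
    intro r hr
    have := heq hr
    simp only at this
    linarith
  intro r hr
  have hr0 : r ≠ 0 := (mem_Ioi.1 (hU hr)).ne'
  have h := hAB hr
  simp only [hA', hB] at h
  -- `r^{L+1} · (r² G'' + 3 r G' − L(L+2) G − s r² G) = -(A' - B) = 0`
  have h2 : r ^ 2 * G'' r + 3 * r * G' r - L * (L + 2) * G r - s * r ^ 2 * G r = 0 := by
    have h' : r ^ (L + 1) * (r ^ 2 * G'' r + 3 * r * G' r - L * (L + 2) * G r - s * r ^ 2 * G r) = 0 := by
      have e3 : r ^ (L + 3) = r ^ (L + 1) * r ^ 2 := by ring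
      have e2 : r ^ (L + 2) = r ^ (L + 1) * r := by ring
      rw [e3, e2] at h
      linear_combination (-1 : ℝ) * h
    exact (mul_eq_zero.1 h').resolve_left (pow_ne_zero _ hr0)
  have e : G'' r + 3 / r * G' r - (((L : ℝ) * ((L : ℝ) + 2)) / r ^ 2 + s) * G r =
      (r ^ 2 * G'' r + 3 * r * G' r - L * (L + 2) * G r - s * r ^ 2 * G r) / r ^ 2 := by
    field_simp
    ring
  rw [e, h2, zero_div]

end Summit.QuantumFields.YangMills.Theorems.F4SubCurvatureDoorHarmonicMomentODE

end
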